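import Mathlib
import Summits.CriticalPhenomena.PercolationContinuityZ3.Theorems.PercNearOneGluingNoHeavyLowerTailOrderedDifferencesQuadraticReduction
import Summits.CriticalPhenomena.PercolationContinuityZ3.Theorems.PercNearOneGluingNoHeavyLowerTailOrderedDifferencesQuadraticCertificates

/-!
# A tangential certificate AT `θ = −1`: no Jordan chain at `−1` over `𝔽₃` ⟹ (C0) at `2 ± √3`

Helper file for crux `stmt-CriticalPhenomena-4575` (`NoHeavyLowerTail`, route `PercNearOneGluingNoHeavy`), new-inequality factory
seat `prim-ineq-gen-3` (gen 30).  Everything here is PROVED; no definitions.  Imports Mathlib and two sibling helper files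
(`…QuadraticReduction`: `quad_mul_expand`, `exists_int_add_int_mul_of_mem_adjoin_quad`; `…QuadraticCertificates`:
`int_indep_of_quad_no_int_root`).  Companion of `…GoldenTangentFive` (memo `CONJECTURE-J.md`).

The class `2 ± √3` (`t² = 4t − 1`) reduces to `t̄ = ∓1` modulo `2` and `3` — the values at which the pencil `U(t) = Z + tY` of a
family with a complement pair is ALWAYS singular — so until now its only finite certificate was `rank_{𝔽₂₅} U(θ) = |𝒜|`
(`…QuadraticCertificates`).  The prime `3` is ramified in `ℚ(√3)`: `X² − 4X + 1 ≡ (X + 1)² (mod 3)`, `√3 = t − 2`, and reduction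
modulo `(√3)² = (3)` lands in `𝔽₃[ε]/(ε²)` with `t ↦ 2 + ε`.  Hence a dependency at `2 ± √3` with unit content yields a LEFT JORDAN
CHAIN OF LENGTH TWO at `θ = 2 = −1` over `𝔽₃`:  `v₀ U(−1) = 0`, `v₁ U(−1) + v₀ Y = 0`, `v₀ ≠ 0`.  Simple eigenvectors at `−1`
(complement pairs!) are harmless: the certificate asks only that none of them extends to a chain — CONJECTURE J(3) says none ever
does (census: no chain at `±1` modulo `3, 5, 7` in > 20 000 families with such eigenvalues, kit j250339–j250342).

* `int_norm_twoSqrt3_eq_zero` — `a² + 4ab + b² = 0` over `ℤ` forces `a = b = 0` (`√3 ∉ ℚ`, descent by `3`).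
* `exists_tangent_chain_of_integral_dependency_twoSqrt3` — ★ an integral dependency `A ↦ a_A + b_A t` (not all zero) at
  `t² = 4t − 1` yields, over any field of characteristic `3`, `v₀ ≠ 0`, `v₁` with `v₀ (Z + 2Y) = 0`, `v₁ (Z + 2Y) + v₀ Y = 0`
  [while `3 ∣ a_A + 2 b_A` for all `A`, divide by `√3 = t − 2`: `(a, b) ↦ (−(2a + b)/3, (a + 2b)/3)`, the measure
  `∑ |a_A² + 4 a_A b_A + b_A²|` (absolute norms) drops by the factor `3`; then `v₀ = a + 2b`, `v₁ = b`].
* `linearIndependent_pencil_twoSqrt3_of_tangent_certificate_three` — ★★ if over a field `F` of characteristic `3` the pencil of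
  `𝒜` has no left Jordan chain of length two at `−1`, then the pencil rows of `𝒜` are linearly independent at every `t` with
  `t² = 4t − 1` over every field of characteristic `0`.
(prim-ineq-gen-3 gen 30, 2026-08-26.)
-/

namespace Summit.CriticalPhenomena.PercolationContinuityZ3.Theorems

namespace OrderedDifferences

open Finset
open scoped FinsetFamily

variable {α : Type*} [DecidableEq α]

/-- `√3` is irrational, norm form version: `a² + 4ab + b² = 0` over `ℤ` forces `a = b = 0`
[`(a + 2b)² = 3b²`; descent by `3` on `|x| + |y|` for `x² = 3y²`]. -/
theorem int_norm_twoSqrt3_eq_zero (a b : ℤ) (h : a * a + 4 * a * b + b * b = 0) : a = 0 ∧ b = 0 := by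
  -- x² = 3 y² has only the trivial solution
  have key : ∀ (n : ℕ) (x y : ℤ), x.natAbs + y.natAbs ≤ n → x * x = 3 * (y * y) → x = 0 ∧ y = 0 := by
    intro n
    induction n with
    | zero => intro x y hle _; omega
    | succ n ih =>
      intro x y hle hxy
      by_cases hx0 : x = 0
      · subst hx0
        have : y * y = 0 := by linarith
        exact ⟨rfl, mul_self_eq_zero.mp this⟩
      -- 3 ∣ x
      have h3 : ∀ z : ZMod 3, z * z = 0 → z = 0 := by decide
      have hx3 : (3 : ℤ) ∣ x := by
        have e := congrArg (fun z : ℤ => (z : ZMod 3)) hxy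
        simp only [Int.cast_mul, Int.cast_ofNat] at e
        have e' : (x : ZMod 3) * (x : ZMod 3) = 0 := by
          rw [e, show (3 : ZMod 3) = 0 by decide, zero_mul]
        exact (ZMod.intCast_zmod_eq_zero_iff_dvd x 3).mp (h3 _ e')
      obtain ⟨x₁, rfl⟩ := hx3
      -- then 3 ∣ y
      have hy : y * y = 3 * (x₁ * x₁) := by linarith
      have hy3 : (3 : ℤ) ∣ y := by
        have e := congrArg (fun z : ℤ => (z : ZMod 3)) hy
        simp only [Int.cast_mul, Int.cast_ofNat] at e
        have e' : (y : ZMod 3) * (y : ZMod 3) = 0 := by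
          rw [e, show (3 : ZMod 3) = 0 by decide, zero_mul]
        exact (ZMod.intCast_zmod_eq_zero_iff_dvd y 3).mp (h3 _ e')
      obtain ⟨y₁, rfl⟩ := hy3
      have h' : x₁ * x₁ = 3 * (y₁ * y₁) := by linarith
      have hx1 : x₁ ≠ 0 := by rintro rfl; exact hx0 (by ring)
      have hlt : x₁.natAbs + y₁.natAbs ≤ n := by
        have e1 : (3 * x₁).natAbs = 3 * x₁.natAbs := by rw [Int.natAbs_mul]; rfl
        have e2 : (3 * y₁).natAbs = 3 * y₁.natAbs := by rw [Int.natAbs_mul]; rfl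
        rw [e1, e2] at hle
        have : x₁.natAbs ≠ 0 := fun h0 => hx1 (Int.natAbs_eq_zero.mp h0)
        omega
      obtain ⟨h1, _⟩ := ih x₁ y₁ hlt h'
      exact absurd h1 hx1
  have hsq : (a + 2 * b) * (a + 2 * b) = 3 * (b * b) := by linear_combination h
  obtain ⟨h1, h2⟩ := key _ (a + 2 * b) b le_rfl hsq
  constructor
  · linarith
  · exact h2

/-- **Integral `2 ± √3` dependency ⟹ Jordan chain of length two at `θ = −1` over characteristic `3`.**  See the module doc-string. -/
theorem exists_tangent_chain_of_integral_dependency_twoSqrt3 (𝒜 : Finset (Finset α))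
    {K : Type*} [Field K] {t : K} (ht : t * t = 4 * t + (-1))
    (hK : ∀ a b : ℤ, (a : K) + (b : K) * t = 0 → a = 0 ∧ b = 0)
    {F : Type*} [Field F] [CharP F 3]
    (a b : ↥𝒜 → ℤ) (hab : ∃ A, a A ≠ 0 ∨ b A ≠ 0)
    (hdep : ∀ E ∈ 𝒜 \\ 𝒜, ∑ A : 𝒜, ((a A : K) + (b A : K) * t) *
        ((if E ⊆ (A : Finset α) then (1 : K) else 0) + t * (if Disjoint E (A : Finset α) then (1 : K) else 0)) = 0) :
    ∃ v₀ v₁ : ↥𝒜 → F, v₀ ≠ 0 ∧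
      (∀ E ∈ 𝒜 \\ 𝒜, ∑ A : 𝒜, v₀ A *
        ((if E ⊆ (A : Finset α) then (1 : F) else 0) + 2 * (if Disjoint E (A : Finset α) then (1 : F) else 0)) = 0) ∧
      (∀ E ∈ 𝒜 \\ 𝒜, ∑ A : 𝒜, (v₁ A *
        ((if E ⊆ (A : Finset α) then (1 : F) else 0) + 2 * (if Disjoint E (A : Finset α) then (1 : F) else 0)) +
          v₀ A * (if Disjoint E (A : Finset α) then (1 : F) else 0)) = 0) := by
  classical
  let zI : ↥𝒜 → Finset α → ℤ := fun A E => if E ⊆ (A : Finset α) then 1 else 0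
  let yI : ↥𝒜 → Finset α → ℤ := fun A E => if Disjoint E (A : Finset α) then 1 else 0
  -- the two integer identities per column (u = 4, v = -1): (I) ∑ (a z − b y) = 0, (II) ∑ (a y + b z + 4 b y) = 0
  have hPQ : ∀ E ∈ 𝒜 \\ 𝒜, (∑ A : 𝒜, (a A * zI A E + (-1) * (b A * yI A E)) = 0) ∧
      (∑ A : 𝒜, (a A * yI A E + b A * zI A E + 4 * (b A * yI A E)) = 0) := by
    intro E hE
    have h := hdep E hE
    have ht' : t * t = ((4 : ℤ) : K) * t + ((-1 : ℤ) : K) := by push_cast; exact ht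
    have e : ∑ A : 𝒜, ((a A : K) + (b A : K) * t) *
        ((if E ⊆ (A : Finset α) then (1 : K) else 0) + t * (if Disjoint E (A : Finset α) then (1 : K) else 0)) =
        ((∑ A : 𝒜, (a A * zI A E + (-1) * (b A * yI A E)) : ℤ) : K) +
          ((∑ A : 𝒜, (a A * yI A E + b A * zI A E + 4 * (b A * yI A E)) : ℤ) : K) * t := by
      push_cast [zI, yI]
      rw [sum_mul, ← sum_add_distrib]
      refine sum_congr rfl fun A _ => ?_
      rw [quad_mul_expand ht']
      push_cast
      ring
    rw [e] at h
    exact hK _ _ h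
  -- descent on ∑ |a² + 4ab + b²|
  suffices H : ∀ (n : ℕ) (a b : ↥𝒜 → ℤ), ∑ A : 𝒜, (a A * a A + 4 * a A * b A + b A * b A).natAbs ≤ n →
      (∃ A, a A ≠ 0 ∨ b A ≠ 0) →
      (∀ E ∈ 𝒜 \\ 𝒜, (∑ A : 𝒜, (a A * zI A E + (-1) * (b A * yI A E)) = 0) ∧
        (∑ A : 𝒜, (a A * yI A E + b A * zI A E + 4 * (b A * yI A E)) = 0)) →
      ∃ v₀ v₁ : ↥𝒜 → F, v₀ ≠ 0 ∧
        (∀ E ∈ 𝒜 \\ 𝒜, ∑ A : 𝒜, v₀ A *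
          ((if E ⊆ (A : Finset α) then (1 : F) else 0) + 2 * (if Disjoint E (A : Finset α) then (1 : F) else 0)) = 0) ∧
        (∀ E ∈ 𝒜 \\ 𝒜, ∑ A : 𝒜, (v₁ A *
          ((if E ⊆ (A : Finset α) then (1 : F) else 0) + 2 * (if Disjoint E (A : Finset α) then (1 : F) else 0)) +
            v₀ A * (if Disjoint E (A : Finset α) then (1 : F) else 0)) = 0) from
    H _ a b le_rfl hab hPQ
  intro n
  induction n with
  | zero =>
    intro a b hle hab _
    exfalso
    obtain ⟨A, hA⟩ := hab
    have h1 : (a A * a A + 4 * a A * b A + b A * b A).natAbs ≤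
        ∑ B : 𝒜, (a B * a B + 4 * a B * b B + b B * b B).natAbs :=
      single_le_sum (f := fun B : ↥𝒜 => (a B * a B + 4 * a B * b B + b B * b B).natAbs) (fun B _ => Nat.zero_le _) (mem_univ A)
    have h0 : a A * a A + 4 * a A * b A + b A * b A = 0 := Int.natAbs_eq_zero.mp (by omega)
    obtain ⟨ha, hb⟩ := int_norm_twoSqrt3_eq_zero _ _ h0
    rcases hA with h | h
    · exact h ha
    · exact h hb
  | succ n ih =>
    intro a b hle hab hz
    by_cases hndvd : ∃ A, ¬ ((3 : ℤ) ∣ a A + 2 * b A)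
    · -- reduce: t ↦ 2 + ε (mod ε²), i.e. θ = -1
      obtain ⟨A0, hA0⟩ := hndvd
      refine ⟨fun A => ((a A + 2 * b A : ℤ) : F), fun A => ((b A : ℤ) : F), ?_, ?_, ?_⟩
      · intro hw
        have h0 := congr_fun hw A0
        simp only [Pi.zero_apply] at h0
        exact hA0 ((CharP.intCast_eq_zero_iff F 3 _).mp h0)
      · intro E hE
        obtain ⟨h1, h2⟩ := hz E hE
        have h3 : ((3 : ℤ) : F) = 0 := by exact_mod_cast CharP.cast_eq_zero F 3
        have e : ∑ A : 𝒜, (((a A + 2 * b A : ℤ)) : F) *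
            ((if E ⊆ (A : Finset α) then (1 : F) else 0) + 2 * (if Disjoint E (A : Finset α) then (1 : F) else 0)) =
            ((∑ A : 𝒜, (a A * zI A E + (-1) * (b A * yI A E)) : ℤ) : F) +
              2 * ((∑ A : 𝒜, (a A * yI A E + b A * zI A E + 4 * (b A * yI A E)) : ℤ) : F) +
              (-((3 : ℤ) : F)) * ∑ A : 𝒜, ((b A : ℤ) : F) * (if Disjoint E (A : Finset α) then (1 : F) else 0) := by
          push_cast [zI, yI]
          rw [mul_sum, mul_sum, ← sum_add_distrib, ← sum_add_distrib]
          refine sum_congr rfl fun A _ => ?_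
          ring
        rw [e, h1, h2, h3]
        push_cast
        ring
      · intro E hE
        obtain ⟨_, h2⟩ := hz E hE
        have e : ∑ A : 𝒜, (((b A : ℤ) : F) *
            ((if E ⊆ (A : Finset α) then (1 : F) else 0) + 2 * (if Disjoint E (A : Finset α) then (1 : F) else 0)) +
              (((a A + 2 * b A : ℤ)) : F) * (if Disjoint E (A : Finset α) then (1 : F) else 0)) =
            ((∑ A : 𝒜, (a A * yI A E + b A * zI A E + 4 * (b A * yI A E)) : ℤ) : F) := by
          push_cast [zI, yI]
          refine sum_congr rfl fun A _ => ?_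
          ring
        rw [e, h2]
        push_cast
        ring
    · -- all a_A + 2 b_A divisible by 3: divide the vector by √3 = t - 2 and recurse
      push Not at hndvd
      -- a' = -(2a + b)/3, b' = (a + 2b)/3
      have hdvd1 : ∀ A, (3 : ℤ) ∣ -(2 * a A + b A) := by
        intro A; obtain ⟨k, hk⟩ := hndvd A; exact ⟨b A - 2 * k, by linarith⟩
      have hdvd2 : ∀ A, (3 : ℤ) ∣ a A + 2 * b A := hndvd
      let a' : ↥𝒜 → ℤ := fun A => (-(2 * a A + b A)) / 3
      let b' : ↥𝒜 → ℤ := fun A => (a A + 2 * b A) / 3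
      have ha3 : ∀ A, 3 * a' A = -(2 * a A + b A) := fun A => Int.mul_ediv_cancel' (hdvd1 A)
      have hb3 : ∀ A, 3 * b' A = a A + 2 * b A := fun A => Int.mul_ediv_cancel' (hdvd2 A)
      have ha : ∀ A, a A = -2 * a' A - b' A := by intro A; have := ha3 A; have := hb3 A; omega
      have hb : ∀ A, b A = a' A + 2 * b' A := by intro A; have := ha3 A; have := hb3 A; omega
      obtain ⟨A0, hA0⟩ := hab
      have hA0' : a' A0 ≠ 0 ∨ b' A0 ≠ 0 := by
        by_contra h
        push Not at h
        have h1 := ha A0; have h2 := hb A0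
        rw [h.1, h.2] at h1 h2
        rcases hA0 with h' | h'
        · exact h' (by omega)
        · exact h' (by omega)
      have hab' : ∃ A, a' A ≠ 0 ∨ b' A ≠ 0 := ⟨A0, hA0'⟩
      -- the measure drops: N(a + bt) = -3 N(a' + b't)
      have hN : ∀ A, a A * a A + 4 * a A * b A + b A * b A = -3 * (a' A * a' A + 4 * a' A * b' A + b' A * b' A) := by
        intro A; rw [ha A, hb A]; ring
      have habs : ∀ A, (a A * a A + 4 * a A * b A + b A * b A).natAbs = 3 * (a' A * a' A + 4 * a' A * b' A + b' A * b' A).natAbs := by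
        intro A; rw [hN A, Int.natAbs_mul]; rfl
      have hle' : ∑ A : 𝒜, (a' A * a' A + 4 * a' A * b' A + b' A * b' A).natAbs ≤ n := by
        have e : ∑ A : 𝒜, (a A * a A + 4 * a A * b A + b A * b A).natAbs =
            3 * ∑ A : 𝒜, (a' A * a' A + 4 * a' A * b' A + b' A * b' A).natAbs := by
          rw [mul_sum]; exact sum_congr rfl fun A _ => habs A
        rw [e] at hle
        have hpos : 1 ≤ ∑ A : 𝒜, (a' A * a' A + 4 * a' A * b' A + b' A * b' A).natAbs := by
          have h1 : (a' A0 * a' A0 + 4 * a' A0 * b' A0 + b' A0 * b' A0).natAbs ≤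
              ∑ B : 𝒜, (a' B * a' B + 4 * a' B * b' B + b' B * b' B).natAbs :=
            single_le_sum (f := fun B : ↥𝒜 => (a' B * a' B + 4 * a' B * b' B + b' B * b' B).natAbs)
              (fun B _ => Nat.zero_le _) (mem_univ A0)
          have h2 : (a' A0 * a' A0 + 4 * a' A0 * b' A0 + b' A0 * b' A0).natAbs ≠ 0 := by
            intro h0
            obtain ⟨h1', h2'⟩ := int_norm_twoSqrt3_eq_zero _ _ (Int.natAbs_eq_zero.mp h0)
            rcases hA0' with h | h
            · exact h h1'
            · exact h h2'
          omega
        omega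
      -- the integer identities persist: 3·(I') = −(2(I) + (II)), 3·(II') = (I) + 2(II)
      have hz' : ∀ E ∈ 𝒜 \\ 𝒜, (∑ A : 𝒜, (a' A * zI A E + (-1) * (b' A * yI A E)) = 0) ∧
          (∑ A : 𝒜, (a' A * yI A E + b' A * zI A E + 4 * (b' A * yI A E)) = 0) := by
        intro E hE
        obtain ⟨h1, h2⟩ := hz E hE
        have e1 : 3 * ∑ A : 𝒜, (a' A * zI A E + (-1) * (b' A * yI A E)) =
            -(2 * ∑ A : 𝒜, (a A * zI A E + (-1) * (b A * yI A E)) +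
              ∑ A : 𝒜, (a A * yI A E + b A * zI A E + 4 * (b A * yI A E))) := by
          rw [mul_sum, mul_sum, ← sum_add_distrib, ← sum_neg_distrib]
          refine sum_congr rfl fun A _ => ?_
          rw [ha A, hb A]
          ring
        have e2 : 3 * ∑ A : 𝒜, (a' A * yI A E + b' A * zI A E + 4 * (b' A * yI A E)) =
            ∑ A : 𝒜, (a A * zI A E + (-1) * (b A * yI A E)) +
              2 * ∑ A : 𝒜, (a A * yI A E + b A * zI A E + 4 * (b A * yI A E)) := by
          rw [mul_sum, mul_sum, ← sum_add_distrib]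
          refine sum_congr rfl fun A _ => ?_
          rw [ha A, hb A]
          ring
        rw [h1, h2] at e1 e2
        constructor
        · have : 3 * ∑ A : 𝒜, (a' A * zI A E + (-1) * (b' A * yI A E)) = 0 := by rw [e1]; ring
          exact (mul_eq_zero.mp this).resolve_left (by norm_num)
        · have : 3 * ∑ A : 𝒜, (a' A * yI A E + b' A * zI A E + 4 * (b' A * yI A E)) = 0 := by rw [e2]; ring
          exact (mul_eq_zero.mp this).resolve_left (by norm_num)
      exact ih a' b' hle' hab' hz'

/-- **The tangential certificate at `−1`: no Jordan chain of length two at `θ = −1` over `𝔽₃` ⟹ (C0) at `2 ± √3`.**  Let `F` be a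
field of characteristic `3` and suppose the pencil of `𝒜` has no left Jordan chain of length two at `t = −1 = 2`: whenever
`v₀ (Z + 2Y) = 0` and `v₁ (Z + 2Y) + v₀ Y = 0` on `𝒜 \\ 𝒜`, `v₀ = 0` (simple eigenvectors at `−1`, e.g. from complement pairs, are
allowed).  Then for every field `K` of characteristic `0` and every `t` with `t * t = 4t − 1` the pencil rows of `𝒜` at `t` are
linearly independent over `K`. -/
theorem linearIndependent_pencil_twoSqrt3_of_tangent_certificate_three (𝒜 : Finset (Finset α))
    {F : Type*} [Field F] [CharP F 3]
    (hF : ∀ v₀ v₁ : ↥𝒜 → F,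
      (∀ E ∈ 𝒜 \\ 𝒜, ∑ A : 𝒜, v₀ A *
        ((if E ⊆ (A : Finset α) then (1 : F) else 0) + 2 * (if Disjoint E (A : Finset α) then (1 : F) else 0)) = 0) →
      (∀ E ∈ 𝒜 \\ 𝒜, ∑ A : 𝒜, (v₁ A *
        ((if E ⊆ (A : Finset α) then (1 : F) else 0) + 2 * (if Disjoint E (A : Finset α) then (1 : F) else 0)) +
          v₀ A * (if Disjoint E (A : Finset α) then (1 : F) else 0)) = 0) →
      v₀ = 0)
    {K : Type*} [Field K] [CharZero K] {t : K} (ht : t * t = 4 * t + (-1)) :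
    LinearIndependent K (fun A : 𝒜 => fun E : (𝒜 \\ 𝒜 : Finset (Finset α)) =>
      (if (E : Finset α) ⊆ (A : Finset α) then (1 : K) else 0) +
        t * (if Disjoint (E : Finset α) (A : Finset α) then (1 : K) else 0)) := by
  classical
  have ht' : t * t = ((4 : ℤ) : K) * t + ((-1 : ℤ) : K) := by push_cast; exact ht
  set R : Subalgebra ℤ K := Algebra.adjoin ℤ ({t} : Set K) with hR
  have htR : t ∈ R := Algebra.subset_adjoin (Set.mem_singleton t)
  let vR : ↥𝒜 → (𝒜 \\ 𝒜 : Finset (Finset α)) → R := fun A E =>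
    ⟨(if (E : Finset α) ⊆ (A : Finset α) then (1 : K) else 0) +
        t * (if Disjoint (E : Finset α) (A : Finset α) then (1 : K) else 0),
      R.add_mem (by split_ifs <;> simp [R.one_mem, R.zero_mem]) (R.mul_mem htR (by split_ifs <;> simp [R.one_mem, R.zero_mem]))⟩
  have hv : (fun A : ↥𝒜 => algebraMap R K ∘ vR A) = (fun A : 𝒜 => fun E : (𝒜 \\ 𝒜 : Finset (Finset α)) =>
      (if (E : Finset α) ⊆ (A : Finset α) then (1 : K) else 0) +
        t * (if Disjoint (E : Finset α) (A : Finset α) then (1 : K) else 0)) := by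
    funext A E
    rfl
  rw [← hv, linearIndependent_algebraMap_comp_iff]
  by_contra hdepR
  obtain ⟨g, hg, A0, hA0⟩ := Fintype.not_linearIndependent_iff.mp hdepR
  have hcoef : ∀ A : ↥𝒜, ∃ ab : ℤ × ℤ, ((g A : R) : K) = (ab.1 : K) + (ab.2 : K) * t := by
    intro A
    obtain ⟨a, b, h⟩ := exists_int_add_int_mul_of_mem_adjoin_quad 4 (-1) ht' (g A).2
    exact ⟨(a, b), h⟩
  choose ab hab using hcoef
  have hno : ∀ n : ℤ, n * n ≠ 4 * n + (-1) := by
    intro n h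
    have h1 : (n - 2) * (n - 2) = 3 := by linear_combination h
    have hb : n - 2 ≤ 1 ∧ -1 ≤ n - 2 := by constructor <;> nlinarith
    have : n = 1 ∨ n = 2 ∨ n = 3 := by omega
    rcases this with rfl | rfl | rfl <;> norm_num at h1
  have hK : ∀ a b : ℤ, (a : K) + (b : K) * t = 0 → a = 0 ∧ b = 0 :=
    fun a b h => int_indep_of_quad_no_int_root 4 (-1) ht' hno a b h
  have hne : ∃ A, (ab A).1 ≠ 0 ∨ (ab A).2 ≠ 0 := by
    refine ⟨A0, ?_⟩
    by_contra h
    push Not at h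
    apply hA0
    have e : ((g A0 : R) : K) = 0 := by rw [hab A0, h.1, h.2]; simp
    exact Subtype.ext e
  have hdep : ∀ E ∈ 𝒜 \\ 𝒜, ∑ A : 𝒜, (((ab A).1 : K) + ((ab A).2 : K) * t) *
      ((if E ⊆ (A : Finset α) then (1 : K) else 0) + t * (if Disjoint E (A : Finset α) then (1 : K) else 0)) = 0 := by
    intro E hE
    have h := congr_fun hg ⟨E, hE⟩
    simp only [Finset.sum_apply, Pi.smul_apply, smul_eq_mul, Pi.zero_apply] at h
    have h' : (((∑ i : ↥𝒜, g i * vR i ⟨E, hE⟩ : R)) : K) = 0 := by rw [h]; rfl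
    have e : ∑ A : 𝒜, (((ab A).1 : K) + ((ab A).2 : K) * t) *
        ((if E ⊆ (A : Finset α) then (1 : K) else 0) + t * (if Disjoint E (A : Finset α) then (1 : K) else 0)) =
        (((∑ i : ↥𝒜, g i * vR i ⟨E, hE⟩ : R)) : K) := by
      push_cast
      refine sum_congr rfl fun A _ => ?_
      rw [hab A]
    rw [e, h']
  obtain ⟨v₀, v₁, hv0, h1, h2⟩ := exists_tangent_chain_of_integral_dependency_twoSqrt3 𝒜 ht hK (F := F)
    (fun A => (ab A).1) (fun A => (ab A).2) hne hdep
  exact hv0 (hF v₀ v₁ h1 h2)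

end OrderedDifferences

end Summit.CriticalPhenomena.PercolationContinuityZ3.Theorems
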